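import Mathlib.LinearAlgebra.Matrix.SpecialLinearGroup
import Mathlib.LinearAlgebra.Matrix.Charpoly.Basic
import Mathlib.LinearAlgebra.Matrix.GeneralLinearGroup.Defs
import Mathlib.RingTheory.IntegralClosure.IsIntegralClosure.Basic
import Mathlib.Analysis.Complex.Basic
import Mathlib.Data.ZMod.Basic
import Mathlib.Algebra.CharP.Defs
import HarnessLib

/-!
# The degree-`3` characters of `PSL₂(𝔽₇) ≅ GL₃(𝔽₂)` reduce modulo `7` to `L(2) = Sym² = Ad⁰`

Let `G = PSL₂(𝔽₇) = SL₂(𝔽₇)/{±1}`, simple of order `168`.  Three printed facts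
(Bonnafé, *Representations of `SL₂(𝔽_q)`* (2011)):

1. [Bonnafe2011, Prop 11.4.4] `PSL₂(𝔽₇) ≅ GL₃(𝔽₂)` (via the reduction modulo `2` of a
   `3`-dimensional representation; cf. [JamesLiebeck2001, Ch. 27] for the character table of the
   simple group of order `168`).
2. [Bonnafe2011, Table 11.4] (character table of `SL₂(𝔽₇)`): the two irreducible characters of
   degree `3`, `R'_±(θ₀)`, are trivial on `-I₂` and take the values `3, 3, 0, 0, -1, 1, 1` on the
   classes of `I₂, -I₂, d(j), d(-j), d'(i), d'(ζ₈), d'(ζ₈³)` (elements of orders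
   `1, 2, 3, 6, 4, 8, 8`, i.e. of orders `1, 1, 3, 3, 2, 4, 4` in `PSL₂(𝔽₇)`) and the values
   `-ϖ*, -ϖ, …` (`ϖ = (1 + √-7)/2`) on the four classes `±u_±` of elements of order `7, 14`.
   Every faithful `3`-dimensional complex representation of `G` has one of these two characters
   (degrees of `G`: `1, 3, 3, 6, 7, 8`; a reducible `3`-dimensional representation of the perfect
   group `G` would contain the trivial character), and the two are exchanged by the outer
   automorphism, so the statement below does not depend on the identification chosen in 1.
3. [Bonnafe2011, Thm 10.1.8, Prop 10.2.9 (f), §10.3.2] (equal characteristic `ℓ = p = q = 7`,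
   where `Dec(𝒪G) = Dec_Δ(𝒪G)`): the simple `k SL₂(𝔽₇)`-modules are `L(n) = Symⁿ(k²)`,
   `0 ≤ n ≤ 6` (those of `PSL₂(𝔽₇)`: `n = 0, 2, 4, 6`, of dimensions `1, 3, 5, 7`), and
   `dec R'_±(ε_{T'}^{(q+1)/2}) = [Δ_q((q-3)/2)] = [L(2)]`: **both degree-`3` characters reduce
   modulo `7` to the Brauer character of `L(2) = Sym²(k²)`**, the adjoint module
   `Ad⁰ = 𝔰𝔩₂(k) ≅ Sym² ⊗ det⁻¹` (Brauer–Nesbitt 1941; Jansen–Lux–Parker–Wilson, *An Atlas of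
   Brauer Characters* (1995), `L₂(7)` mod `7`).

For `g ∈ SL₂(𝔽₇)` with eigenvalues `α, α⁻¹` and trace `t`, `Sym²`/`Ad⁰` has eigenvalues
`α², 1, α⁻²`, hence characteristic polynomial `(X - 1)(X² - (t² - 2)X + 1)` — the shape in which
route Langlands/`PSL2ArtinDoor` (crux `ResidualSymSquareDoor`, stmt-Langlands-1996) consumes the
fact: `Ad⁰(ρ̄_f)(Frob_q)` has characteristic polynomial `(X - 1)(X² - (a_q²/(ε(q)q^{w-1}) - 2)X + 1)`.
Since a Brauer character determines characteristic polynomials modulo `𝔓` on `7`-regular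
elements, and on `7`-singular elements (orders `7, 14`; `t = ±2`) both sides are `(X - 1)³`
(`7`-th roots of unity reduce to `1`), fact 3 is equivalent to the identity of reduced
characteristic polynomials for EVERY `g ∈ SL₂(𝔽₇)`, which is what is vendored.  Worked check from
Table 11.4 alone: `t = ±2 ↦ (X-1)³`; order `3` (`t = ∓1`, character value `0`, eigenvalues
`1, ω, ω²`) `↦ (X-1)(X²+X+1)`; order `4` in `SL₂` (`t = 0`, value `-1`, eigenvalues `1, -1, -1`)
`↦ (X-1)(X+1)²`; order `8` (`t² = 2`, value `1`, eigenvalues `1, i, -i`) `↦ (X-1)(X²+1)`.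

This file states the NAMED FACT `psl27_degreeThree_charpoly_mod_seven` (a finite, GAP/kernel-
certifiable computation, not yet proved in the tree): for every group `Γ ≅ GL₃(𝔽₂)` there is a
surjection `π : SL₂(𝔽₇) ↠ Γ` with kernel `{±I₂}` such that for every injective
`ρ : Γ → GL₃(ℂ)`, every field `k` of characteristic `7`, every ring homomorphism `red : ℤ̄ → k`
(`ℤ̄ = integralClosure ℤ ℂ`) and every `g ∈ SL₂(𝔽₇)`, the characteristic polynomial of `ρ(π g)`
has coefficients in `ℤ̄` and reduces under `red` to `(X - 1)(X² - (tr(g)² - 2)X + 1)`.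

## References

* [Bonnafe2011] C. Bonnafé, *Representations of SL₂(𝔽_q)*, Algebra and Applications 13, Springer
  (2011): Thm 10.1.8, Prop 10.2.9 (f), §10.3.2, Table 11.4, Prop 11.4.4.
* [JamesLiebeck2001] G. James, M. Liebeck, *Representations and Characters of Groups*, 2nd ed.
  (2001), Ch. 27 (character table of `PSL(2,7)`).
* R. Brauer, C. Nesbitt, *On the modular characters of groups*, Ann. of Math. 42 (1941) §30.
* C. Jansen, K. Lux, R. Parker, R. Wilson, *An Atlas of Brauer Characters*, OUP (1995), `L₂(7)`.
-/

noncomputable section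

open Polynomial

namespace Literature.RepresentationTheory.FiniteGroups

/-- **The degree-`3` characters of `PSL₂(𝔽₇) ≅ GL₃(𝔽₂)` reduce modulo `7` to
`L(2) = Sym² = Ad⁰`** (Bonnafé 2011: Prop 11.4.4 for `PSL₂(𝔽₇) ≅ GL₃(𝔽₂)`, Table 11.4 for the
degree-`3` characters `R'_±(θ₀)` of `SL₂(𝔽₇)`, trivial on `-I₂`, Thm 10.1.8 + Prop 10.2.9 (f) for
their `7`-modular reduction `[L(2)]`), in characteristic-polynomial form: for every group `Γ`
isomorphic to `GL₃(𝔽₂)` there is a surjective homomorphism `π : SL₂(𝔽₇) → Γ` with kernel `{±I₂}`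
(so `Γ ≅ PSL₂(𝔽₇)`) such that for every injective `ρ : Γ → GL₃(ℂ)` (a faithful, hence
irreducible, `3`-dimensional representation), every field `k` of characteristic `7`, every ring
homomorphism `red : ℤ̄ → k` from the algebraic integers `ℤ̄ = integralClosure ℤ ℂ`, and every
`g ∈ SL₂(𝔽₇)`: `det(X - ρ(π g))` is (the image of) a polynomial `P ∈ ℤ̄[X]` whose reduction
`red(P)` equals `(X - 1)(X² - (tr(g)² - 2)X + 1)`, the characteristic polynomial of `g` on
`Sym²(k²) ≅ Ad⁰` (eigenvalues `α², 1, α⁻²` for `g` with eigenvalues `α, α⁻¹`).  See the module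
docstring for the class-by-class check from Table 11.4.
[cite: Bonnafe2011, Table 11.4, Prop 10.2.9 (f), Prop 11.4.4] -/
def psl27_degreeThree_charpoly_mod_seven : Prop :=
  ∀ (Γ : Type) [Group Γ], Nonempty (Γ ≃* GL (Fin 3) (ZMod 2)) →
    ∃ π : Matrix.SpecialLinearGroup (Fin 2) (ZMod 7) →* Γ,
      Function.Surjective π ∧
      (∀ g : Matrix.SpecialLinearGroup (Fin 2) (ZMod 7),
        π g = 1 ↔ ((g : Matrix (Fin 2) (Fin 2) (ZMod 7)) = 1 ∨
          (g : Matrix (Fin 2) (Fin 2) (ZMod 7)) = -1)) ∧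
      ∀ (ρ : Γ →* GL (Fin 3) ℂ), Function.Injective ρ →
        ∀ (k : Type) [Field k] [CharP k 7] (red : integralClosure ℤ ℂ →+* k)
          (g : Matrix.SpecialLinearGroup (Fin 2) (ZMod 7)),
          ∃ P : Polynomial (integralClosure ℤ ℂ),
            P.map (algebraMap (integralClosure ℤ ℂ) ℂ) =
              ((ρ (π g) : GL (Fin 3) ℂ) : Matrix (Fin 3) (Fin 3) ℂ).charpoly ∧
            P.map red =
              (X - 1) * (X ^ 2 - C ((ZMod.castHom (dvd_refl 7) k
                (g : Matrix (Fin 2) (Fin 2) (ZMod 7)).trace) ^ 2 - 2) * X + 1)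

/-- The `Sym²`/`Ad⁰` characteristic polynomial `(X - 1)(X² - (t² - 2)X + 1)` attached to a trace
`t`, as it appears in `psl27_degreeThree_charpoly_mod_seven` and in crux `ResidualSymSquareDoor`
of route Langlands/PSL2ArtinDoor (there with `t² = a_q²/(ε(q) q^{w-1})`). [folklore] -/
def adZeroCharpoly {R : Type*} [CommRing R] (t : R) : Polynomial R :=
  (X - 1) * (X ^ 2 - C (t ^ 2 - 2) * X + 1)

/-- `adZeroCharpoly t` is monic of the displayed shape; at `t = ±2` (the `7`-singular classes
`±u_±` of `SL₂(𝔽₇)`, and `±I₂`) it is `(X - 1)³`. [folklore] -/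
theorem adZeroCharpoly_two {R : Type*} [CommRing R] :
    adZeroCharpoly (2 : R) = (X - 1) ^ 3 ∧ adZeroCharpoly (-2 : R) = (X - 1) ^ 3 := by
  constructor <;>
  · simp only [adZeroCharpoly]
    have h : ((2 : R) ^ 2 - 2) = 2 := by norm_num
    have h' : ((-2 : R) ^ 2 - 2) = 2 := by norm_num
    simp only [h, h', map_ofNat]
    ring

/-- Unfolding: the reduced polynomial in `psl27_degreeThree_charpoly_mod_seven` is
`adZeroCharpoly (tr g)`. [folklore] -/
theorem adZeroCharpoly_eq {R : Type*} [CommRing R] (t : R) :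
    adZeroCharpoly t = (X - 1) * (X ^ 2 - C (t ^ 2 - 2) * X + 1) := rfl

end Literature.RepresentationTheory.FiniteGroups

end
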